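import Mathlib
import Summits.Ventures.PercRepro2.CoinD21Alg
import Summits.Ventures.PercRepro2.CoinOrTailAlg
import Summits.Ventures.PercRepro2.CoinOrTail3Cells

/-!
# The OR-tail with ONE FAR MARKER over two log-supermodular branches: the abstract functional
(blind cell PercRepro2, night-2 g9; proofs/NIGHT2-DARC.md §36)

`orTail3_functional_nonneg`: as `orTail_functional_nonneg` (CoinOrTailAlg.lean), but the marker
of the first branch is a vertex `p` that is NOT the attachment point `r` of the tail: the tail
is entered from `r` (probability `δ`) and from the second marker `q` (probability `ε`), and the
weight `ν` vanishes on the sets containing `r` but not `p` (`p` is a cut vertex between the root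
and `r`: every cluster containing `r` contains `p`).  The first branch then has THREE classes
(`p ∉ W`; `p ∈ W, r ∉ W`; `r ∈ W`), the second two, and the sixteen cell sums
`cellSum3 … bp br bq X` are the sixteen head values of the five-vertex two-route core
`s → p → r → a ← q ← s` with the markers `p, q` (g8's `d21_cert`, CoinD21Alg.lean): the seven
moments are the five-vertex core's with the class weights absorbed (`α = 1, α' = 1/2,
β = β' = γ = γ' = 1`), its eighteen log-supermodular steps hold for the cell sums by
Ahlswede–Daykin (`cellSum3_mul_le`), its ten monotone steps termwise, and `d21_cert` closes.
-/

namespace Summit.Ventures.PercRepro2.Coin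

section OrTail3Alg

variable {V : Type*} [DecidableEq V] {R : Type*} [Field R] [LinearOrder R] [IsStrictOrderedRing R]

/-- **THE ONE-FAR-MARKER OR-TAIL FUNCTIONAL IS NONNEGATIVE** (cell-averaging + Ahlswede–Daykin
+ `d21_cert`).  Hypotheses: `a, w ∉ U`; `δ, ε ∈ [0, 1]`; `ν ≥ 0` log-supermodular on the subsets
of `U` and vanishing on the sets containing `r` but not `p`; `A ≥ 0` decreasing and
log-supermodular.  Conclusion: the cleared functional with the `R`-values `rVal A r q a δ ε`
(the tail entered from `r` and `q`), the gate values `gVal A r q a w δ ε`, and the MARKERS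
`x = 1[p ∈ W]`, `y = 1[q ∈ W]` is nonnegative. -/
theorem orTail3_functional_nonneg (U : Finset V) (ν A : Finset V → R) (p r q a w : V) (δ ε : R)
    (haU : a ∉ U) (hwU : w ∉ U)
    (hδ0 : 0 ≤ δ) (hδ1 : δ ≤ 1) (hε0 : 0 ≤ ε) (hε1 : ε ≤ 1)
    (hν0 : ∀ W, 0 ≤ ν W) (hν : ∀ s ⊆ U, ∀ t ⊆ U, ν s * ν t ≤ ν (s ∩ t) * ν (s ∪ t))
    (hbad : ∀ W ⊆ U, r ∈ W → p ∉ W → ν W = 0)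
    (hA0 : ∀ W, 0 ≤ A W) (hA : ∀ s t : Finset V, A s * A t ≤ A (s ∩ t) * A (s ∪ t))
    (hAmono : ∀ s t : Finset V, s ⊆ t → A t ≤ A s) :
    0 ≤ (∑ W ∈ U.powerset, ν W * rVal A r q a δ ε W) ^ 2 *
          (∑ W ∈ U.powerset, ν W * gVal A r q a w δ ε W *
            ((if p ∈ W then (1 : R) else 0) * (if q ∈ W then (1 : R) else 0)))
        - (∑ W ∈ U.powerset, ν W * rVal A r q a δ ε W) *
          (∑ W ∈ U.powerset, ν W * rVal A r q a δ ε W * (if p ∈ W then (1 : R) else 0)) *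
          (∑ W ∈ U.powerset, ν W * gVal A r q a w δ ε W * (if q ∈ W then (1 : R) else 0))
        - (∑ W ∈ U.powerset, ν W * rVal A r q a δ ε W) *
          (∑ W ∈ U.powerset, ν W * rVal A r q a δ ε W * (if q ∈ W then (1 : R) else 0)) *
          (∑ W ∈ U.powerset, ν W * gVal A r q a w δ ε W * (if p ∈ W then (1 : R) else 0))
        + (∑ W ∈ U.powerset, ν W * rVal A r q a δ ε W * (if p ∈ W then (1 : R) else 0)) *
          (∑ W ∈ U.powerset, ν W * rVal A r q a δ ε W * (if q ∈ W then (1 : R) else 0)) *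
          (∑ W ∈ U.powerset, ν W * gVal A r q a w δ ε W) := by
  -- the sixteen cell sums (names as in `d21_cert`)
  set A_e := cellSum3 U ν A p r q false false false ∅ with hA_e
  set A_a := cellSum3 U ν A p r q false false false {a} with hA_a
  set A_p := cellSum3 U ν A p r q true false false ∅ with hA_p
  set A_q := cellSum3 U ν A p r q false false true ∅ with hA_q
  set A_ap := cellSum3 U ν A p r q true false false {a} with hA_ap
  set A_aq := cellSum3 U ν A p r q false false true {a} with hA_aq
  set A_pq := cellSum3 U ν A p r q true false true ∅ with hA_pq
  set A_pr := cellSum3 U ν A p r q true true false ∅ with hA_pr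
  set A_apq := cellSum3 U ν A p r q true false true {a} with hA_apq
  set A_apr := cellSum3 U ν A p r q true true false {a} with hA_apr
  set A_aqw := cellSum3 U ν A p r q false false true {a, w} with hA_aqw
  set A_pqr := cellSum3 U ν A p r q true true true ∅ with hA_pqr
  set A_apqr := cellSum3 U ν A p r q true true true {a} with hA_apqr
  set A_apqw := cellSum3 U ν A p r q true false true {a, w} with hA_apqw
  set A_aprw := cellSum3 U ν A p r q true true false {a, w} with hA_aprw
  set A_apqrw := cellSum3 U ν A p r q true true true {a, w} with hA_apqrw
  have hXa : Disjoint ({a} : Finset V) U := Finset.disjoint_singleton_left.2 haU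
  have hXaw : Disjoint ({a, w} : Finset V) U := by
    rw [Finset.disjoint_left]
    intro x hx
    simp only [Finset.mem_insert, Finset.mem_singleton] at hx
    rcases hx with rfl | rfl
    · exact haU
    · exact hwU
  have hX0 : Disjoint (∅ : Finset V) U := Finset.disjoint_empty_left U
  have L := cellSum3_mul_le U ν A p r q hν0 hν hA0 hA
  -- the eighteen log-supermodular steps
  have hl1 : A_apq * A_aprw ≤ A_ap * A_apqrw := by
    have := L true false true true true false {a} {a, w} hXa hXaw
    simpa only [Bool.and_self, Bool.and_false, Bool.false_and, Bool.or_self, Bool.true_or,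
      Bool.or_true, Bool.false_or, singleton_inter_pair, singleton_union_pair] using this
  have hl2 : A_apq * A_aqw ≤ A_aq * A_apqw := by
    have := L true false true false false true {a} {a, w} hXa hXaw
    simpa only [Bool.and_self, Bool.and_false, Bool.false_and, Bool.or_self, Bool.true_or,
      Bool.or_true, Bool.false_or, singleton_inter_pair, singleton_union_pair] using this
  have hl3 : A_apqr * A_aprw ≤ A_apr * A_apqrw := by
    have := L true true true true true false {a} {a, w} hXa hXaw
    simpa only [Bool.and_self, Bool.and_false, Bool.false_and, Bool.or_self, Bool.true_or,
      Bool.or_true, Bool.false_or, singleton_inter_pair, singleton_union_pair] using this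
  have hl4 : A_apr * A_aqw ≤ A_a * A_apqrw := by
    have := L true true false false false true {a} {a, w} hXa hXaw
    simpa only [Bool.and_self, Bool.and_false, Bool.false_and, Bool.or_self, Bool.true_or,
      Bool.or_true, Bool.false_or, singleton_inter_pair, singleton_union_pair] using this
  have hl5 : A_aq * A_aprw ≤ A_a * A_apqrw := by
    have := L false false true true true false {a} {a, w} hXa hXaw
    simpa only [Bool.and_self, Bool.and_false, Bool.false_and, Bool.or_self, Bool.true_or,
      Bool.or_true, Bool.false_or, singleton_inter_pair, singleton_union_pair] using this
  have hl6 : A_aq * A_pr ≤ A_e * A_apqr := by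
    have := L false false true true true false {a} ∅ hXa hX0
    simpa only [Bool.and_self, Bool.and_false, Bool.false_and, Bool.or_self, Bool.true_or,
      Bool.or_true, Bool.false_or, Finset.inter_empty, Finset.union_empty] using this
  have hl7 : A_aqw * A_apqr ≤ A_aq * A_apqrw := by
    have := L false false true true true true {a, w} {a} hXaw hXa
    simpa only [Bool.and_self, Bool.and_false, Bool.false_and, Bool.or_self, Bool.true_or,
      Bool.or_true, Bool.false_or, Finset.inter_comm ({a, w} : Finset V) {a},
      Finset.union_comm ({a, w} : Finset V) {a}, singleton_inter_pair, singleton_union_pair]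
      using this
  have hl8 : A_aqw * A_pqr ≤ A_q * A_apqrw := by
    have := L false false true true true true {a, w} ∅ hXaw hX0
    simpa only [Bool.and_self, Bool.and_false, Bool.false_and, Bool.or_self, Bool.true_or,
      Bool.or_true, Bool.false_or, Finset.inter_empty, Finset.union_empty] using this
  have hl9 : A_p * A_aq ≤ A_e * A_apq := by
    have := L true false false false false true ∅ {a} hX0 hXa
    simpa only [Bool.and_self, Bool.and_false, Bool.false_and, Bool.or_self, Bool.true_or,
      Bool.or_true, Bool.false_or, Finset.empty_inter, Finset.empty_union] using this
  have hl10 : A_p * A_aqw ≤ A_e * A_apqw := by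
    have := L true false false false false true ∅ {a, w} hX0 hXaw
    simpa only [Bool.and_self, Bool.and_false, Bool.false_and, Bool.or_self, Bool.true_or,
      Bool.or_true, Bool.false_or, Finset.empty_inter, Finset.empty_union] using this
  have hl11 : A_p * A_q ≤ A_e * A_pq := by
    have := L true false false false false true ∅ ∅ hX0 hX0
    simpa only [Bool.and_self, Bool.and_false, Bool.false_and, Bool.or_self, Bool.true_or,
      Bool.or_true, Bool.false_or, Finset.empty_inter, Finset.empty_union] using this
  have hl12 : A_pq * A_aprw ≤ A_p * A_apqrw := by
    have := L true false true true true false ∅ {a, w} hX0 hXaw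
    simpa only [Bool.and_self, Bool.and_false, Bool.false_and, Bool.or_self, Bool.true_or,
      Bool.or_true, Bool.false_or, Finset.empty_inter, Finset.empty_union] using this
  have hl13 : A_pq * A_aqw ≤ A_q * A_apqw := by
    have := L true false true false false true ∅ {a, w} hX0 hXaw
    simpa only [Bool.and_self, Bool.and_false, Bool.false_and, Bool.or_self, Bool.true_or,
      Bool.or_true, Bool.false_or, Finset.empty_inter, Finset.empty_union] using this
  have hl14 : A_pqr * A_aprw ≤ A_pr * A_apqrw := by
    have := L true true true true true false ∅ {a, w} hX0 hXaw
    simpa only [Bool.and_self, Bool.and_false, Bool.false_and, Bool.or_self, Bool.true_or,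
      Bool.or_true, Bool.false_or, Finset.empty_inter, Finset.empty_union] using this
  have hl15 : A_pr * A_aqw ≤ A_e * A_apqrw := by
    have := L true true false false false true ∅ {a, w} hX0 hXaw
    simpa only [Bool.and_self, Bool.and_false, Bool.false_and, Bool.or_self, Bool.true_or,
      Bool.or_true, Bool.false_or, Finset.empty_inter, Finset.empty_union] using this
  have hl16 : A_q * A_apr ≤ A_e * A_apqr := by
    have := L false false true true true false ∅ {a} hX0 hXa
    simpa only [Bool.and_self, Bool.and_false, Bool.false_and, Bool.or_self, Bool.true_or,
      Bool.or_true, Bool.false_or, Finset.empty_inter, Finset.empty_union] using this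
  have hl17 : A_q * A_aprw ≤ A_e * A_apqrw := by
    have := L false false true true true false ∅ {a, w} hX0 hXaw
    simpa only [Bool.and_self, Bool.and_false, Bool.false_and, Bool.or_self, Bool.true_or,
      Bool.or_true, Bool.false_or, Finset.empty_inter, Finset.empty_union] using this
  have hl18 : A_q * A_pr ≤ A_e * A_pqr := by
    have := L false false true true true false ∅ ∅ hX0 hX0
    simpa only [Bool.and_self, Bool.and_false, Bool.false_and, Bool.or_self, Bool.true_or,
      Bool.or_true, Bool.false_or, Finset.empty_inter, Finset.empty_union] using this
  -- the ten monotone steps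
  have M := cellSum3_mono U ν A p r q hν0 hAmono
  have ha_aw : ({a} : Finset V) ⊆ {a, w} := by simp
  have h0_a : (∅ : Finset V) ⊆ {a} := Finset.empty_subset _
  have h0_aw : (∅ : Finset V) ⊆ {a, w} := Finset.empty_subset _
  have hm1 : A_aprw ≤ A_apr := M true true false {a} {a, w} ha_aw
  have hm2 : A_aqw ≤ A_aq := M false false true {a} {a, w} ha_aw
  have hm3 : A_a ≤ A_e := M false false false ∅ {a} h0_a
  have hm4 : A_ap ≤ A_p := M true false false ∅ {a} h0_a
  have hm5 : A_apq ≤ A_pq := M true false true ∅ {a} h0_a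
  have hm6 : A_apqr ≤ A_pqr := M true true true ∅ {a} h0_a
  have hm7 : A_apr ≤ A_pr := M true true false ∅ {a} h0_a
  have hm8 : A_aprw ≤ A_pr := M true true false ∅ {a, w} h0_aw
  have hm9 : A_aq ≤ A_q := M false false true ∅ {a} h0_a
  have hm10 : A_aqw ≤ A_q := M false false true ∅ {a, w} h0_aw
  have N := cellSum3_nonneg U ν A p r q hν0 hA0
  -- the five-vertex certificate on the cell sums
  have key := d21_cert (1 : R) (1 / 2) 1 1 1 1 δ (1 - δ) ε (1 - ε) A_e A_a A_p A_q A_ap A_aq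
    A_pq A_pr A_apq A_apr A_aqw A_pqr A_apqr A_apqw A_aprw A_apqrw zero_le_one (by norm_num)
    zero_le_one zero_le_one zero_le_one zero_le_one hδ0 (sub_nonneg.2 hδ1) hε0
    (sub_nonneg.2 hε1) (N _ _ _ _) (N _ _ _ _) (N _ _ _ _) (N _ _ _ _) (N _ _ _ _) (N _ _ _ _)
    (N _ _ _ _) (N _ _ _ _) (N _ _ _ _) (N _ _ _ _) (N _ _ _ _) (N _ _ _ _) (N _ _ _ _) (N _ _ _ _)
    hl1 hl2 hl3 hl4 hl5 hl6 hl7 hl8 hl9 hl10 hl11 hl12 hl13 hl14 hl15 hl16 hl17 hl18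
    hm1 hm2 hm3 hm4 hm5 hm6 hm7 hm8 hm9 hm10
  -- the seven moments as combinations of the cell sums (on the good sets)
  have hpt : ∀ W ∈ U.powerset,
      ν W * goodWt p r W * rVal A r q a δ ε W =
        ν W * cellWt3 p r q false false false W * A (W ∪ ∅)
        + (ν W * cellWt3 p r q true false false W * A (W ∪ ∅))
        + (1 - ε) * (ν W * cellWt3 p r q false false true W * A (W ∪ ∅))
        + ε * (ν W * cellWt3 p r q false false true W * A (W ∪ {a}))
        + (1 - ε) * (ν W * cellWt3 p r q true false true W * A (W ∪ ∅))
        + ε * (ν W * cellWt3 p r q true false true W * A (W ∪ {a}))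
        + (1 - δ) * (ν W * cellWt3 p r q true true false W * A (W ∪ ∅))
        + δ * (ν W * cellWt3 p r q true true false W * A (W ∪ {a}))
        + (1 - δ) * (1 - ε) * (ν W * cellWt3 p r q true true true W * A (W ∪ ∅))
        + (δ * ε + δ * (1 - ε) + (1 - δ) * ε) * (ν W * cellWt3 p r q true true true W * A (W ∪ {a})) := by
    intro W _
    simp only [rVal, tailWt, cellWt3, mWt, goodWt, Finset.union_empty]
    by_cases hp : p ∈ W <;> by_cases hr : r ∈ W <;> by_cases hq : q ∈ W <;>
      simp [hp, hr, hq] <;> ring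
  have hpg : ∀ W ∈ U.powerset,
      ν W * goodWt p r W * gVal A r q a w δ ε W =
        ν W * cellWt3 p r q false false false W * A (W ∪ ∅)
        + (ν W * cellWt3 p r q true false false W * A (W ∪ ∅))
        + (1 - ε) * (ν W * cellWt3 p r q false false true W * A (W ∪ ∅))
        + ε * (ν W * cellWt3 p r q false false true W * A (W ∪ {a, w}))
        + (1 - ε) * (ν W * cellWt3 p r q true false true W * A (W ∪ ∅))
        + ε * (ν W * cellWt3 p r q true false true W * A (W ∪ {a, w}))
        + (1 - δ) * (ν W * cellWt3 p r q true true false W * A (W ∪ ∅))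
        + δ * (ν W * cellWt3 p r q true true false W * A (W ∪ {a, w}))
        + (1 - δ) * (1 - ε) * (ν W * cellWt3 p r q true true true W * A (W ∪ ∅))
        + (δ * ε + δ * (1 - ε) + (1 - δ) * ε) * (ν W * cellWt3 p r q true true true W * A (W ∪ {a, w})) := by
    intro W _
    simp only [gVal, tailWt, cellWt3, mWt, goodWt, Finset.union_empty]
    by_cases hp : p ∈ W <;> by_cases hr : r ∈ W <;> by_cases hq : q ∈ W <;>
      simp [hp, hr, hq] <;> ring
  have hΛ : ∑ W ∈ U.powerset, ν W * rVal A r q a δ ε W =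
      A_e + A_p + (1 - ε) * A_q + ε * A_aq + (1 - ε) * A_pq + ε * A_apq + (1 - δ) * A_pr
        + δ * A_apr + (1 - δ) * (1 - ε) * A_pqr + (δ * ε + δ * (1 - ε) + (1 - δ) * ε) * A_apqr := by
    rw [sum_eq_sum_goodWt U ν p r hbad]
    simp only [hA_e, hA_p, hA_q, hA_aq, hA_pq, hA_apq, hA_pr, hA_apr, hA_pqr, hA_apqr, cellSum3,
      Finset.mul_sum, ← Finset.sum_add_distrib]
    exact Finset.sum_congr rfl hpt
  have hFa : ∑ W ∈ U.powerset, ν W * rVal A r q a δ ε W * (if p ∈ W then (1 : R) else 0) =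
      A_p + (1 - ε) * A_pq + ε * A_apq + (1 - δ) * A_pr + δ * A_apr + (1 - δ) * (1 - ε) * A_pqr
        + (δ * ε + δ * (1 - ε) + (1 - δ) * ε) * A_apqr := by
    rw [sum_eq_sum_goodWt' U ν p r hbad]
    simp only [hA_p, hA_pq, hA_apq, hA_pr, hA_apr, hA_pqr, hA_apqr, cellSum3, Finset.mul_sum,
      ← Finset.sum_add_distrib]
    refine Finset.sum_congr rfl fun W hW => ?_
    rw [hpt W hW]
    simp only [cellWt3, mWt, Finset.union_empty]
    by_cases hp : p ∈ W <;> by_cases hr : r ∈ W <;> by_cases hq : q ∈ W <;> simp [hp, hr, hq]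
  have hFb : ∑ W ∈ U.powerset, ν W * rVal A r q a δ ε W * (if q ∈ W then (1 : R) else 0) =
      (1 - ε) * A_q + ε * A_aq + (1 - ε) * A_pq + ε * A_apq + (1 - δ) * (1 - ε) * A_pqr
        + (δ * ε + δ * (1 - ε) + (1 - δ) * ε) * A_apqr := by
    rw [sum_eq_sum_goodWt' U ν p r hbad]
    simp only [hA_q, hA_aq, hA_pq, hA_apq, hA_pqr, hA_apqr, cellSum3, Finset.mul_sum,
      ← Finset.sum_add_distrib]
    refine Finset.sum_congr rfl fun W hW => ?_
    rw [hpt W hW]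
    simp only [cellWt3, mWt, Finset.union_empty]
    by_cases hp : p ∈ W <;> by_cases hr : r ∈ W <;> by_cases hq : q ∈ W <;> simp [hp, hr, hq]
  have hM : ∑ W ∈ U.powerset, ν W * gVal A r q a w δ ε W =
      A_e + A_p + (1 - ε) * A_q + ε * A_aqw + (1 - ε) * A_pq + ε * A_apqw + (1 - δ) * A_pr
        + δ * A_aprw + (1 - δ) * (1 - ε) * A_pqr
        + (δ * ε + δ * (1 - ε) + (1 - δ) * ε) * A_apqrw := by
    rw [sum_eq_sum_goodWt U ν p r hbad]
    simp only [hA_e, hA_p, hA_q, hA_aqw, hA_pq, hA_apqw, hA_pr, hA_aprw, hA_pqr, hA_apqrw, cellSum3,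
      Finset.mul_sum, ← Finset.sum_add_distrib]
    exact Finset.sum_congr rfl hpg
  have hX : ∑ W ∈ U.powerset, ν W * gVal A r q a w δ ε W * (if p ∈ W then (1 : R) else 0) =
      A_p + (1 - ε) * A_pq + ε * A_apqw + (1 - δ) * A_pr + δ * A_aprw
        + (1 - δ) * (1 - ε) * A_pqr + (δ * ε + δ * (1 - ε) + (1 - δ) * ε) * A_apqrw := by
    rw [sum_eq_sum_goodWt' U ν p r hbad]
    simp only [hA_p, hA_pq, hA_apqw, hA_pr, hA_aprw, hA_pqr, hA_apqrw, cellSum3, Finset.mul_sum,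
      ← Finset.sum_add_distrib]
    refine Finset.sum_congr rfl fun W hW => ?_
    rw [hpg W hW]
    simp only [cellWt3, mWt, Finset.union_empty]
    by_cases hp : p ∈ W <;> by_cases hr : r ∈ W <;> by_cases hq : q ∈ W <;> simp [hp, hr, hq]
  have hY : ∑ W ∈ U.powerset, ν W * gVal A r q a w δ ε W * (if q ∈ W then (1 : R) else 0) =
      (1 - ε) * A_q + ε * A_aqw + (1 - ε) * A_pq + ε * A_apqw + (1 - δ) * (1 - ε) * A_pqr
        + (δ * ε + δ * (1 - ε) + (1 - δ) * ε) * A_apqrw := by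
    rw [sum_eq_sum_goodWt' U ν p r hbad]
    simp only [hA_q, hA_aqw, hA_pq, hA_apqw, hA_pqr, hA_apqrw, cellSum3, Finset.mul_sum,
      ← Finset.sum_add_distrib]
    refine Finset.sum_congr rfl fun W hW => ?_
    rw [hpg W hW]
    simp only [cellWt3, mWt, Finset.union_empty]
    by_cases hp : p ∈ W <;> by_cases hr : r ∈ W <;> by_cases hq : q ∈ W <;> simp [hp, hr, hq]
  have hXY : ∑ W ∈ U.powerset, ν W * gVal A r q a w δ ε W *
      ((if p ∈ W then (1 : R) else 0) * (if q ∈ W then (1 : R) else 0)) =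
      (1 - ε) * A_pq + ε * A_apqw + (1 - δ) * (1 - ε) * A_pqr
        + (δ * ε + δ * (1 - ε) + (1 - δ) * ε) * A_apqrw := by
    rw [sum_eq_sum_goodWt' U ν p r hbad]
    simp only [hA_pq, hA_apqw, hA_pqr, hA_apqrw, cellSum3, Finset.mul_sum,
      ← Finset.sum_add_distrib]
    refine Finset.sum_congr rfl fun W hW => ?_
    rw [hpg W hW]
    simp only [cellWt3, mWt, Finset.union_empty]
    by_cases hp : p ∈ W <;> by_cases hr : r ∈ W <;> by_cases hq : q ∈ W <;> simp [hp, hr, hq]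
  rw [hΛ, hFa, hFb, hM, hX, hY, hXY]
  linear_combination key

end OrTail3Alg

end Summit.Ventures.PercRepro2.Coin
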